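import Literature.MathematicalPhysics.QuantumFieldTheory.Balaban1983to89.B9SupplySockB9P3ZdLetters

/-!
# `Balaban1983to89.B9SupplySockB9P3Zd` — [Balaban1985BackgroundPropagators] THEOREM 3.3 (BY NAME, `B9.Thm33Printed`) AT THE `ℤᵈ × 𝔸`
# CARRIER SUPPLIES THE IN-EDGE b9 OF [Balaban1985RegularSpaces]: `∀ m ≤ k, B8LeafModelZd3.SockB9P3 …` — B8 p. 86 «Theorem 3.3 of [4] implies
# the bounds (1.59)», kernel-checked modulo the operator-letter binders of `B9SupplySockB9P3ZdLetters`

statement-level skeleton of published theorems with citation tags; proofs where landed; nothing here is a claim about the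
Yang–Mills mass gap

PDF held: `paper:balaban1985-cmp99-regular-spaces-gauge-fixing` (journal page = PDF page + 74), p. 86 (1.55)–(1.59), p. 87 Prop. 3;
`paper:balaban1985-cmp99-background-propagators` (journal page = PDF page + 388), pp. 392–399, 404.

WHY THIS FILE (cell `pub-ymgap`, seat `pub-ymgap-dag-n06-b` g4, junction J-N06→N05 = dag-lead REACTIVATE №9, census item (1) of dag-n19-b's
J-N06-N05-CENSUS v1.1; count-neutral).  The consumer (N05 knit, `B8LeafSocketsB9.sockB9P3_of_allLevels`∕`sockH59_of_allLevels`) wants ONE b9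
target per member of the `zdGF3` family: «`∀ m ≤ k, SockB9P3 L B₀ B₀β cP β len η m Ω Λs Λb`».  This file proves it from [4] THEOREM 3.3 taken as
a HYPOTHESIS OF PRINTED SHAPE — `B9.Thm33Printed c35 geo bg Gp GA` BY NAME, over any [B9] frame carrying the member readings of the `ℤᵈ` datum
(`DictGlob`) — together with the five operator binders of the letters file (what B8 p. 86 uses of [4] Sect. A: (3.27) `InvOnSupp`, (3.69)
`CurvSmall`, (3.20)–(3.21)∕(1.42) `LandauKills`, (3.16)∕(1.56) `AvgBound`, Prop. 3's «B₀(β₀) the norm of G(U₀)» `HolderGlob`) and Prop. 6 in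
[4]'s shape (`Prop6Feed`).  THE PROOF IS PRINT'S: for the socket's datum (α₀, α₂ ≤ cP; U₀, W = e^{iηA′} unitary; U₀ ∈ 𝔄_m; the Landau condition
of record for W; A′ Hermitian, |A′| ≤ α₂(Lʲη)⁻¹ on the E_j, 0 elsewhere): (i) (3.35) for U₀ from Prop. 6, hence Theorem 3.3's blocks for
G(U₀) at [4]'s α₀ = K₆α₀ (M := max{1, M₁, M₃}, Mα₀ small); (ii) the W-form Landau condition is the condition for A′ (`landau_of_landauW`:
`(iη)⁻¹log W = A′` on the bonds of Ω₀ by `B8Prop3GaugeFixedKLevel.logField_spec`, locality `B8Eq138LandauZd.isLandau138_congr`); (iii) A′ =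
G(U₀)J̃ with J̃ = Δ_a(U₀)A′ = J + Δ′A′ + 0 + Q*aQA′ ((1.58): `InvOnSupp`, `LandauKills`); (iv) |J̃|₍₋₃₎ ≤ |J|₍₋₃₎ + c₆₉Mα₀|A′|₍₋₁₎ + q|B₁|
pointwise (`CurvSmall`, `AvgBound`; J = D*DA′ is bounded since A′ is — `norm_Jcur_le_of_grad`); (v) (3.47) at γ = −3 through the dictionary:
|A′|₍₋₁₎, |∇A′|₍₋₂₎, |ΔA′|₍₋₃₎ ≤ B₀|J̃|₍₋₃₎ (`B9.glob_at_minus_three`) and the Hölder line ≤ C_H Bβ(β)|J̃|₍₋₃₎; (vi) the Neumann∕a-priori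
step of G-IF-01 (`B8FromB9.norm_le_of_fixedPoint` in the concrete norms): with θ = B₀c₆₉MK₆α₀ ≤ ½, |A′|₍₋₁₎ ≤ 2B₀(|J|₍₋₃₎ + q|B₁|) and every entry
≤ 2·const·max{1,q}·(|J|₍₋₃₎ + |B₁|) — (1.59) with B8's B₀ READ AS B₀′ = max{1, 2B₀max{1,q}} (`B8FromB9.b8_159_repaired`'s repaired constant;
the |D*DA′|₍₋₃₎ line is (1.55) itself, `B8FromB9.b8_159_DstarD_entry`) and B₀(β) as 2max{0, C_H Bβ(β)}max{1,q}.

WHAT IS PROVED (kernel, 0 sorry, theorems only).  `landau_of_landauW`; `sockB9P3_at` (ONE datum `i`, ONE level `m`, ONE block parameter `M ≥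
max{1,M₃}`, Theorem 3.3's GA-block for the member as a hypothesis-function of (α₀, U₀) with explicit constants; explicit B₀′, B₀β′, cP);
**`sockB9P3_allLevels_of_thm33`**: `B9.Thm33Printed c35 geo bg Gp GA` + `DictGlob` + the six binders ⇒ `∃ B₀ B₀β cP, 0 < B₀ ∧ 0 ≤ B₀β ∧ 0 < cP ∧
∀ i : ZdIdx d L, ∀ m ≤ i.k, SockB9P3 L B₀ B₀β cP β len i.η m i.Ω i.Λs i.Λb` — the consumer's H of `sockB9P3_of_allLevels`∕`sockH59_of_allLevels`
verbatim, with `inp.B₀ := B₀` for `B8LeafModelZd3.prop3Printed_zd3`.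

HONEST CENSUS (REACTIVATE №9 §3 — which clauses are NOT reached from `Thm33Printed` alone).  (a) Lines 1, 2, 4 of (1.59) ⟸ the γ = −3 global
entries n = 0, 1, 3 of (3.47) in `Thm33Printed`'s GA block (entry n = 2, `G∇*`, unused); (b) line 3 (`|D*DA′|₍₋₃₎`) IS (1.55)'s J — reached
trivially with B₀′ ≥ 1; (c) line 5 (Hölder, B₀(β)) is NOT reached from `Thm33Printed`'s typed blocks: its (3.43)∕(3.45) entries are LOCAL (cut-offs
ζ ∈ C₀^∞(Δ̃(y))) and (3.47) has no Hölder member — the global weighted Hölder operator norm B8 Prop. 3 asserts («the corresponding norms of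
G(U₀)») is the extra binder `HolderGlob` (printed shape: (3.43) + Lemma 2.1); (d) the support clause of the socket («A′ = 0 off the E_j») is
USED (Dirichlet domain of Δ_a↾Ω₀, `OnE`), the clause `WU₀ ∈ 𝔄` and the Hermiticity of A′ are NOT used (they serve (1.55), not (1.59)); (e) (3.35)
is fed by Prop. 6 (`Prop6Feed`), [4]'s α₀ = K₆·α₀, smallness `Mα₀ ≤ min{c₆, a₀∕K₆, a₃∕K₆, (2B₀c₆₉K₆)⁻¹}` at the fixed M — so cP depends on
Theorem 3.3's constants and M (INTERFACE NOTE: served as `∃ cP > 0`); (f) NOT HERE (object-bound, N06): the letters G(U₀), Δ′(U₀), R(U₀), Q_j*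
as OPERATORS at the carrier ([4] Sect. A (3.10)–(3.27), Thm 3.11) and `Thm33Printed` itself at a genuine instance; `d ≥ 2`, `L ≥ 1` assumed
(as `B8LeafModelZd3.prop3Printed_zd3`).  Count-neutral; N05∕N06 NOT discharged; one finite lattice programme; nothing continuum ∕ ℝ⁴ ∕ OS ∕
mass-gap ∕ Clay.  Unit `pub-ymgap-dag-n06-b` (g4), 2026-08-26.
-/

noncomputable section

open NormedSpace

namespace Literature.MathematicalPhysics.QuantumFieldTheory.Balaban1983to89.B9SupplySockB9P3Zd

open Complex (I)
open B7Prop1Explicit (U1 e)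
open B7Prop2Explicit (unitaryUnits unitaryUnits_le_U1)
open B7Prop4GeneralLevels (linCovIter)
open B8Ineq132 (covDerivFwd covDeriv InAk BondTouches)
open B8Eq184Proof (cfgExp)
open B8Eq140Level (SideTouches)
open B8Eq146AExpansion (iEta plaqCovDeriv)
open B8Eq143PlaqExpansion (pdiv)
open B8Eq155JBound (Jcur wsup)
open B8ScaledSupNorm (bondNorm msup weight Bdd)
open B8Eq138LandauZd (IsLandau138 IsLandau138W logCfg covLap)
open B8LeafModelZd (ZdIdx)
open B8LeafModelZd3 (SockB9P3)
open B9Eq340HolderZd (hquot AdmPair)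
open B9SupplySockB9P3ZdLetters (OpsZd deltaAOf OnE DictGlob Prop6Feed InvOnSupp CurvSmall LandauKills AvgBound HolderGlob)

-- `Site` alone could resolve to the torus sites of `Setup.lean`; re-export the `ℤ^d` sites of `B7Prop1Explicit`.
export B7Prop1Explicit (Site)

variable {d : ℕ} {𝔸 : Type*} [CStarAlgebra 𝔸]

/-! ## §1 Lemmas: the Landau condition for A′, the boundedness of J = D*DA′ -/

/-- **THE SOCKET'S W-FORM LANDAU CONDITION IS THE CONDITION FOR A′.**  If `W = e^{iηA′}` with `|A′| ≤ α₂(Lʲη)⁻¹` on the sides of the plaquettes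
touching `Ω_j` (`j ≤ m`), `16α₂ ≤ 1`, `W` unitary-valued and `d ≥ 2`, then on every bond with an end-point in `Ω₀` (a side of a plaquette touching
`Ω₀`) `(iη)⁻¹log W = A′` (`B8Prop3GaugeFixedKLevel.logField_spec`), so (1.38) for `W` — `IsLandau138W … W := IsLandau138 … ((iη)⁻¹log W)` — is (1.38)
for `A′` by locality (`B8Eq138LandauZd.isLandau138_congr`). [cite: Balaban1985RegularSpaces, (1.36)–(1.38) p.82, (1.41)–(1.42) p.83] -/
theorem landau_of_landauW (hd2 : 2 ≤ d) {L m : ℕ} {η : ℝ} (hη : 0 < η) {Ω : ℕ → Set (Site d)} {Λs : ℕ → ℕ → Set (Site d)}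
    (U₀ : Site d → Fin d → 𝔸ˣ) {W : Site d → Fin d → 𝔸ˣ} (hWu : ∀ x κ, W x κ ∈ unitaryUnits 𝔸)
    {A' : Site d → Fin d → 𝔸} {α₂ : ℝ} (h16 : α₂ ≤ 1 / 16)
    (h41 : ∀ j, j ≤ m → ∀ (y : Site d) (τ : Fin d), SideTouches (Ω j) y τ →
      W y τ = cfgExp η A' y τ ∧ ‖A' y τ‖ ≤ α₂ * ((L : ℝ) ^ j * η)⁻¹)
    (hLan : IsLandau138W L m η (Ω 0) (Λs m) U₀ W) : IsLandau138 L m η (Ω 0) (Λs m) U₀ A' := by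
  refine (B8Eq138LandauZd.isLandau138_congr η L U₀ fun x μ hb => ?_).1 hLan
  haveI : Nontrivial (Fin d) := Fin.nontrivial_iff_two_le.mpr hd2
  obtain ⟨κ, hκ⟩ := exists_ne μ
  have hs : SideTouches (Ω 0) x μ := B8Eq140Level.sideTouches_of_bondTouches hκ hb
  obtain ⟨hW, hA⟩ := h41 0 (Nat.zero_le _) x μ hs
  have hA' : ‖A' x μ‖ ≤ α₂ * η⁻¹ := by simpa using hA
  exact (B8Prop3GaugeFixedKLevel.logField_spec hη U₀ hWu hW hA' h16).1

variable [Nontrivial 𝔸]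

/-- A crude pointwise bound on B8's current `J = D^{η*}_{U₀}D^η_{U₀}A` (1.55) from a bound `G` on the covariant gradient of `A` and a unitary-type
background: `|J_μ(x)| ≤ 8d·η⁻¹·G` (each plaquette derivative is `≤ 2G`, `B8Ineq1141SectG.norm_plaqCovDeriv_le`; each backward covariant
difference costs `η⁻¹·(|·| + |·|)`, `B8Eq143PlaqExpansion.norm_covDeriv_le`; at most `d` terms in each of the two sums of (3.9)).  Used only to
certify that the weighted family of `J` is bounded (the real supremum `|J|₍₋₃₎` is attained). [cite: Balaban1985RegularSpaces, (1.55) p.86, (1.1)–(1.2) p.76; Balaban1985BackgroundPropagators, (3.9) p.392] -/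
theorem norm_Jcur_le_of_grad {η : ℝ} (hη : 0 < η) {U₀ : Site d → Fin d → 𝔸ˣ} (hU₀ : ∀ y κ, U₀ y κ ∈ U1 𝔸)
    {A : Site d → Fin d → 𝔸} {G : ℝ} (hG : ∀ (y : Site d) (κ τ : Fin d), ‖covDerivFwd η U₀ κ (fun z => A z τ) y‖ ≤ G)
    (μ : Fin d) (x : Site d) : ‖Jcur η U₀ A μ x‖ ≤ 8 * d * (η⁻¹ * G) := by
  have hG0 : 0 ≤ G := (norm_nonneg _).trans (hG x μ μ)
  have hF : ∀ (a b : Fin d) (y : Site d), ‖plaqCovDeriv η U₀ A a b y‖ ≤ 2 * G :=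
    fun a b y => B8Ineq1141SectG.norm_plaqCovDeriv_le U₀ hG a b y
  have hcd : ∀ (ν : Fin d) (F : Site d → 𝔸), (∀ y, ‖F y‖ ≤ 2 * G) → ‖covDeriv η U₀ ν F x‖ ≤ η⁻¹ * (4 * G) := by
    intro ν F hFb
    refine (B8Eq143PlaqExpansion.norm_covDeriv_le hη (hU₀ _ _) F).trans ?_
    exact mul_le_mul_of_nonneg_left (by linarith [hFb (x - e ν), hFb x]) (inv_nonneg.mpr hη.le)
  have hcard : ∀ s : Finset (Fin d), (s.card : ℝ) ≤ d := fun s => by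
    exact_mod_cast (Finset.card_le_univ s).trans_eq (Fintype.card_fin d)
  have hc0 : 0 ≤ η⁻¹ * (4 * G) := by positivity
  rw [B8Eq155JBound.Jcur_def]
  unfold pdiv
  calc ‖(∑ ν ∈ Finset.Iio μ, covDeriv η U₀ ν (plaqCovDeriv η U₀ A ν μ) x) -
          ∑ ν ∈ Finset.Ioi μ, covDeriv η U₀ ν (plaqCovDeriv η U₀ A μ ν) x‖
      ≤ ‖∑ ν ∈ Finset.Iio μ, covDeriv η U₀ ν (plaqCovDeriv η U₀ A ν μ) x‖ +
          ‖∑ ν ∈ Finset.Ioi μ, covDeriv η U₀ ν (plaqCovDeriv η U₀ A μ ν) x‖ := norm_sub_le _ _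
    _ ≤ (∑ ν ∈ Finset.Iio μ, η⁻¹ * (4 * G)) + ∑ ν ∈ Finset.Ioi μ, η⁻¹ * (4 * G) :=
        add_le_add (norm_sum_le_of_le _ fun ν _ => hcd ν _ fun y => hF ν μ y)
          (norm_sum_le_of_le _ fun ν _ => hcd ν _ fun y => hF μ ν y)
    _ = (((Finset.Iio μ).card : ℝ) + (Finset.Ioi μ).card) * (η⁻¹ * (4 * G)) := by
        rw [Finset.sum_const, Finset.sum_const, nsmul_eq_mul, nsmul_eq_mul]; ring
    _ ≤ ((d : ℝ) + d) * (η⁻¹ * (4 * G)) := mul_le_mul_of_nonneg_right (add_le_add (hcard _) (hcard _)) hc0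
    _ = 8 * d * (η⁻¹ * G) := by ring

omit [Nontrivial 𝔸] in
/-- A uniformly bounded bond family has a bounded `(Lʲη)³`-weighted family over finitely many levels `j ≤ m` (`L ≥ 1`, `η > 0`): the boundedness
side condition of r05's `msup` for `|·|₍₋₃₎`. [cite: Balaban1985RegularSpaces, p.86 (definition after (1.55))] -/
theorem bdd_neg_three_of_pointwise {L m : ℕ} (hL : 1 ≤ L) {η : ℝ} (hη : 0 < η) {Ω : ℕ → Set (Site d)}
    {J : Site d × Fin d → 𝔸} {c : ℝ} (h : ∀ b, ‖J b‖ ≤ c) :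
    Bdd L m η (-(3 : ℝ)) (fun j (b : Site d × Fin d) => BondTouches (Ω j) b.1 b.2) J := by
  have e3 : (-(3 : ℝ)) = -((3 : ℕ) : ℝ) := by norm_num
  rw [e3]
  refine B8ScaledSupNorm.bdd_of_forall (c := ((L : ℝ) ^ m * η) ^ 3 * max c 0) fun j hj b _ => ?_
  rw [B8ScaledSupNorm.weight_neg_natCast]
  have hLr : (1 : ℝ) ≤ L := by exact_mod_cast hL
  have h1 : ((L : ℝ) ^ j * η) ^ 3 ≤ ((L : ℝ) ^ m * η) ^ 3 :=
    pow_le_pow_left₀ (by positivity) (mul_le_mul_of_nonneg_right (pow_le_pow_right₀ hLr hj) hη.le) 3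
  exact mul_le_mul h1 ((h b).trans (le_max_left _ _)) (norm_nonneg _) (by positivity)

/-! ## §2 The a-priori (Neumann) arithmetic of G-IF-01 in the concrete norms -/

omit [Nontrivial 𝔸] in
/-- **THE REPAIRED-CONSTANT ARITHMETIC OF (1.59)** (`B8FromB9.norm_le_of_fixedPoint` ∕ `b8_159_printed_shape` ∕ `transfer_constant_le_two` in one
real-number statement): if the source obeys `N ≤ |J| + κ′·a + q·|B₁|`, the entries obey `a, g, l ≤ B₀N`, `h ≤ C_β N`, and `B₀κ′ ≤ ½`, then
`a, g, |J|, l ≤ max{1, 2B₀max{1,q}}·(|J| + |B₁|)` and `h ≤ 2C_β max{1,q}·(|J| + |B₁|)`. [cite: Balaban1985RegularSpaces, (1.59)–(1.60) p.86 (B8's «B₀» read as the repaired constant)] -/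
theorem apriori_arith {a g l h nJ nJ' nB N B₀ κ' q Cβ : ℝ} (hB₀ : 0 < B₀) (hq : 0 ≤ q) (hκ' : 0 ≤ κ') (hθ : B₀ * κ' ≤ 1 / 2)
    (ha0 : 0 ≤ a) (hnJ : 0 ≤ nJ) (hnB : 0 ≤ nB) (hCβ : 0 ≤ Cβ) (hJJ : nJ' = nJ)
    (hN : N ≤ nJ + κ' * a + q * nB) (h1 : a ≤ B₀ * N) (h2 : g ≤ B₀ * N) (h4 : l ≤ B₀ * N) (h5 : h ≤ Cβ * N) :
    a ≤ max 1 (2 * B₀ * max 1 q) * (nJ + nB) ∧ g ≤ max 1 (2 * B₀ * max 1 q) * (nJ + nB) ∧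
      nJ' ≤ max 1 (2 * B₀ * max 1 q) * (nJ + nB) ∧ l ≤ max 1 (2 * B₀ * max 1 q) * (nJ + nB) ∧
      h ≤ 2 * Cβ * max 1 q * (nJ + nB) := by
  subst hJJ
  have hX : 0 ≤ nJ' + q * nB := by positivity
  have hsum : 0 ≤ nJ' + nB := add_nonneg hnJ hnB
  have hθa : B₀ * κ' * a ≤ 1 / 2 * a := mul_le_mul_of_nonneg_right hθ ha0
  have hθX : B₀ * κ' * (nJ' + q * nB) ≤ 1 / 2 * (nJ' + q * nB) := mul_le_mul_of_nonneg_right hθ hX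
  have haN : a ≤ B₀ * (nJ' + κ' * a + q * nB) := h1.trans (mul_le_mul_of_nonneg_left hN hB₀.le)
  have ha : a ≤ 2 * B₀ * (nJ' + q * nB) := by linarith
  have hκa : κ' * a ≤ κ' * (2 * B₀ * (nJ' + q * nB)) := mul_le_mul_of_nonneg_left ha hκ'
  have hmq : nJ' + q * nB ≤ max 1 q * (nJ' + nB) := by
    have h₁ : 1 * nJ' ≤ max 1 q * nJ' := mul_le_mul_of_nonneg_right (le_max_left 1 q) hnJ
    have h₂ : q * nB ≤ max 1 q * nB := mul_le_mul_of_nonneg_right (le_max_right 1 q) hnB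
    linarith
  have hN2 : N ≤ 2 * max 1 q * (nJ' + nB) := by linarith
  have hB' : 2 * B₀ * max 1 q * (nJ' + nB) ≤ max 1 (2 * B₀ * max 1 q) * (nJ' + nB) :=
    mul_le_mul_of_nonneg_right (le_max_right _ _) hsum
  have h1' : 1 * (nJ' + nB) ≤ max 1 (2 * B₀ * max 1 q) * (nJ' + nB) := mul_le_mul_of_nonneg_right (le_max_left _ _) hsum
  have hma : 2 * B₀ * (nJ' + q * nB) ≤ 2 * B₀ * (max 1 q * (nJ' + nB)) := mul_le_mul_of_nonneg_left hmq (by positivity)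
  have hgN : B₀ * N ≤ B₀ * (2 * max 1 q * (nJ' + nB)) := mul_le_mul_of_nonneg_left hN2 hB₀.le
  have hhN : Cβ * N ≤ Cβ * (2 * max 1 q * (nJ' + nB)) := mul_le_mul_of_nonneg_left hN2 hCβ
  refine ⟨by linarith, by linarith, by linarith, by linarith, by linarith⟩

/-! ## §3 The supply theorem at one member, and the family form from `B9.Thm33Printed` -/

section Supply

variable {I : Type} (geo : I → B9.Geometry) (bg : I → B9.Backgrounds) (GA : ∀ i, B9.KernelFamily (geo i) (bg i))
variable (L : ℕ) (mem : ℝ → ZdIdx d L → ℕ → I)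
variable (ιCfg : ∀ (M : ℝ) (i : ZdIdx d L) (m : ℕ) (U₀ : Site d → Fin d → 𝔸ˣ),
  (∀ x κ, U₀ x κ ∈ unitaryUnits 𝔸) → (bg (mem M i m)).Cfg)
variable (ιLoc : ∀ (M : ℝ) (i : ZdIdx d L) (m : ℕ), (Site d → Fin d → 𝔸) → (geo (mem M i m)).Loc)
variable (ops : ℝ → ZdIdx d L → ℕ → OpsZd d 𝔸)

/-- **THEOREM 3.3 FOR G(U₀) AT ONE MEMBER SUPPLIES THE b9 SOCKET AT THAT DATUM AND LEVEL** (B8 p. 86 «Theorem 3.3 of [4] implies the bounds (1.59)»,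
with the located Δ′-transfer G-IF-01 and the constant repair of `B8FromB9.b8_159_repaired`).  Data: the [B9] frame with the member readings
`DictGlob`, the operator binders `InvOnSupp`∕`CurvSmall`∕`LandauKills`∕`AvgBound`∕`HolderGlob`, Prop. 6 `Prop6Feed`, a block parameter `M ≥ max{1, M₃}`,
and THEOREM 3.3's GA-block of the member `(M, i, m)` — «for every 0 < α₀ with Mα₀ ≤ a₀ and every U satisfying (3.35): (3.42)–(3.47) and
(3.43)–(3.45) for G(U) with constants B₀, δ₀, B₀(·), …» — as the hypothesis `h33U`.  Conclusion: `SockB9P3` at level `m` with B₀′ = max{1, 2B₀max{1,q}},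
B₀(β)′ = 2max{0, C_H Bβ(β)}max{1,q}, cP = min{1∕16, c₆∕M, a₀∕(K₆M), a₃∕(K₆M), 1∕(2B₀c₆₉K₆M + 1)}.
[cite: Balaban1985RegularSpaces, (1.58)–(1.59) p.86, Prop. 3 p.87; Balaban1985BackgroundPropagators, Thm 3.3 p.399, (3.26)–(3.27) p.395, (3.47) p.398, (3.69) p.404] -/
theorem sockB9P3_at (hd2 : 2 ≤ d) (hL : 1 ≤ L) {c35 c₆ K₆ M₃ a₃ c69 q CH β : ℝ} {len : Site d → ℝ}
    (hdict : DictGlob geo bg GA L mem ιCfg ιLoc ops) (hP6 : Prop6Feed bg L mem ιCfg c35 M₃ c₆ K₆)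
    (hinv : InvOnSupp bg L mem ιCfg ops c35 M₃ a₃) (hcurv : CurvSmall bg L mem ιCfg ops c35 M₃ a₃ c69)
    (hlan : LandauKills bg L mem ιCfg ops c35 M₃ a₃) (havg : AvgBound L ops q)
    (hhol : HolderGlob geo bg GA L mem ιCfg ops β len CH)
    (hK₆ : 0 < K₆) (hc69 : 0 ≤ c69) (hq : 0 ≤ q)
    {M : ℝ} (hM1 : 1 ≤ M) (hM₃ : M₃ ≤ M) (i : ZdIdx d L) (m : ℕ)
    {B₀ δ₀ a₀ : ℝ} {Bβ Bε : ℝ → ℝ} {Bεβ : ℝ → ℝ → ℝ} (hB₀ : 0 < B₀)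
    (h33U : ∀ (α₀ : ℝ) (U₀ : Site d → Fin d → 𝔸ˣ) (hU₀ : ∀ x κ, U₀ x κ ∈ unitaryUnits 𝔸), 0 < α₀ → M * α₀ ≤ a₀ →
      (bg (mem M i m)).Reg335 c35 α₀ (ιCfg M i m U₀ hU₀) →
      B9.Ineq342_346_347 (GA (mem M i m)) B₀ δ₀ (ιCfg M i m U₀ hU₀) ∧
        B9.Ineq343_345 (GA (mem M i m)) Bβ Bε Bεβ δ₀ (ιCfg M i m U₀ hU₀)) :
    SockB9P3 (𝔸 := 𝔸) L (max 1 (2 * B₀ * max 1 q)) (2 * max 0 (CH * Bβ β) * max 1 q)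
      (min (1 / 16) (min (c₆ / M) (min (a₀ / (K₆ * M)) (min (a₃ / (K₆ * M)) (1 / (2 * B₀ * c69 * K₆ * M + 1))))))
      β len i.η m i.Ω i.Λs i.Λb := by
  intro α₀ α₂ hα₀ hα₀c hα₂ hα₂c U₀ W hU₀ hWu hInA _ hLanW A' _ h41 hA0
  -- the thresholds
  have hη : 0 < i.η := i.hη
  have hLr : (1 : ℝ) ≤ L := by exact_mod_cast hL
  have hM0 : 0 < M := lt_of_lt_of_le one_pos hM1
  have hKM : 0 < K₆ * M := mul_pos hK₆ hM0
  simp only [le_min_iff] at hα₀c hα₂c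
  obtain ⟨-, hα₀c6, hα₀a0, hα₀a3, hα₀θ⟩ := hα₀c
  obtain ⟨hα₂16, -, -, -, -⟩ := hα₂c
  have hc6 : M * α₀ ≤ c₆ := by rw [mul_comm]; exact (le_div_iff₀ hM0).1 hα₀c6
  have ha₉0 : 0 < K₆ * α₀ := mul_pos hK₆ hα₀
  have ha0' : M * (K₆ * α₀) ≤ a₀ := by
    have h := (le_div_iff₀ hKM).1 hα₀a0
    calc M * (K₆ * α₀) = α₀ * (K₆ * M) := by ring
      _ ≤ a₀ := h
  have ha3' : M * (K₆ * α₀) ≤ a₃ := by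
    have h := (le_div_iff₀ hKM).1 hα₀a3
    calc M * (K₆ * α₀) = α₀ * (K₆ * M) := by ring
      _ ≤ a₃ := h
  have hκ' : 0 ≤ c69 * M * (K₆ * α₀) := by positivity
  have hθ : B₀ * (c69 * M * (K₆ * α₀)) ≤ 1 / 2 := by
    have hpos : 0 < 2 * B₀ * c69 * K₆ * M + 1 := by positivity
    have h1 : α₀ * (2 * B₀ * c69 * K₆ * M + 1) ≤ 1 := (le_div_iff₀ hpos).1 hα₀θ
    linarith [hα₀.le]
  -- (3.35) for U₀ by Proposition 6, and Theorem 3.3's blocks for G(U₀)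
  have hreg : (bg (mem M i m)).Reg335 c35 (K₆ * α₀) (ιCfg M i m U₀ hU₀) := hP6 M i m hM₃ α₀ U₀ hU₀ hα₀ hc6 hInA
  obtain ⟨h347, h345⟩ := h33U (K₆ * α₀) U₀ hU₀ ha₉0 ha0' hreg
  obtain ⟨-, hd⟩ := hdict M i m
  -- A′ is a field of the class E
  have hU₀1 : ∀ x κ, U₀ x κ ∈ U1 𝔸 := fun x κ => unitaryUnits_le_U1 (hU₀ x κ)
  have hAbd : Bdd L m i.η (-(1 : ℝ)) (fun j (b : Site d × Fin d) => SideTouches (i.Ω j) b.1 b.2) (fun b => A' b.1 b.2) := by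
    have e1 : (-(1 : ℝ)) = -((1 : ℕ) : ℝ) := by norm_num
    rw [e1]
    refine B8ScaledSupNorm.bdd_of_forall (c := α₂) fun j hj b hb => ?_
    rw [B8ScaledSupNorm.weight_neg_natCast, pow_one]
    have h := (h41 j hj b.1 b.2 hb).2
    have hs : 0 < (L : ℝ) ^ j * i.η := B8ScaledSupNorm.scale_pos hL hη j
    calc (L : ℝ) ^ j * i.η * ‖A' b.1 b.2‖ ≤ (L : ℝ) ^ j * i.η * (α₂ * ((L : ℝ) ^ j * i.η)⁻¹) :=
          mul_le_mul_of_nonneg_left h hs.le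
      _ = α₂ := by rw [mul_comm α₂, ← mul_assoc, mul_inv_cancel₀ hs.ne', one_mul]
  have hOnE : OnE L m i.η i.Ω A' := ⟨hA0, hAbd⟩
  obtain ⟨a, ha_def⟩ : ∃ a : ℝ,
      a = msup L m i.η (-(1 : ℝ)) (fun j (b : Site d × Fin d) => SideTouches (i.Ω j) b.1 b.2) (fun b => A' b.1 b.2) :=
    ⟨_, rfl⟩
  have ha0 : 0 ≤ a := by rw [ha_def]; exact B8ScaledSupNorm.msup_nonneg L m hη.le _ _ _
  -- the Landau condition for A′; the source J̃ = Δ_a(U₀)A′ and A′ = G(U₀)J̃ ((1.58))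
  have hLanA : IsLandau138 L m i.η (i.Ω 0) (i.Λs m) U₀ A' := landau_of_landauW hd2 hη U₀ hWu hα₂16 h41 hLanW
  obtain ⟨Jt, hJt_def⟩ : ∃ Jt : Site d → Fin d → 𝔸, Jt = deltaAOf i.η (ops M i m) U₀ A' := ⟨_, rfl⟩
  have hGJ : (ops M i m).Gop U₀ Jt = A' := by
    rw [hJt_def]; exact hinv M i m hM₃ (K₆ * α₀) U₀ hU₀ ha₉0 ha3' hreg A' hOnE
  have hDRD : ∀ (x : Site d) (μ : Fin d), (ops M i m).DRDs U₀ A' x μ = 0 :=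
    hlan M i m hM₃ (K₆ * α₀) U₀ hU₀ ha₉0 ha3' hreg A' hOnE hLanA
  have hJtb : ∀ (x : Site d) (μ : Fin d),
      Jt x μ = Jcur i.η U₀ A' μ x + (ops M i m).Dp U₀ A' x μ + (ops M i m).DRDs U₀ A' x μ + (ops M i m).QQ U₀ A' x μ := by
    intro x μ; rw [hJt_def]; rfl
  -- the right-hand side of the socket: |J|₍₋₃₎ and |B₁|
  obtain ⟨nJ, hnJ_def⟩ : ∃ nJ : ℝ, nJ = bondNorm L m i.η (-(3 : ℝ)) i.Ω (fun x μ => Jcur i.η U₀ A' μ x) := ⟨_, rfl⟩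
  obtain ⟨nB, hnB_def⟩ : ∃ nB : ℝ, nB = wsup 1 (fun p : {p : ℕ × (Site d × Fin d) // p.1 ≤ m ∧ p.2 ∈ i.Λb m p.1} =>
      linCovIter L U₀ (iEta i.η A') p.1.1 p.1.2.1 p.1.2.2) := ⟨_, rfl⟩
  have hnJ0 : 0 ≤ nJ := by rw [hnJ_def]; exact B8ScaledSupNorm.msup_nonneg L m hη.le _ _ _
  have hnB0 : 0 ≤ nB := by rw [hnB_def]; exact B8Eq155JBound.wsup_nonneg zero_le_one _
  -- J is bounded (A′ is): the real supremum |J|₍₋₃₎ is attained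
  have hAglob : ∀ (y : Site d) (τ : Fin d), ‖A' y τ‖ ≤ α₂ * i.η⁻¹ := by
    intro y τ
    by_cases hmem : ∃ j, j ≤ m ∧ SideTouches (i.Ω j) y τ
    · obtain ⟨j, hj, hs⟩ := hmem
      have hLj : (1 : ℝ) ≤ (L : ℝ) ^ j := one_le_pow₀ hLr
      calc ‖A' y τ‖ ≤ α₂ * ((L : ℝ) ^ j * i.η)⁻¹ := (h41 j hj y τ hs).2
        _ = α₂ * i.η⁻¹ * ((L : ℝ) ^ j)⁻¹ := by rw [mul_inv]; ring
        _ ≤ α₂ * i.η⁻¹ * 1 := by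
            apply mul_le_mul_of_nonneg_left (inv_le_one_of_one_le₀ hLj) (by positivity)
        _ = α₂ * i.η⁻¹ := mul_one _
    · rw [hA0 y τ fun j hj hs => hmem ⟨j, hj, hs⟩, norm_zero]
      positivity
  have hgrad : ∀ (y : Site d) (κ τ : Fin d), ‖covDerivFwd i.η U₀ κ (fun z => A' z τ) y‖ ≤ 2 * α₂ * i.η⁻¹ * i.η⁻¹ := by
    intro y κ τ
    unfold covDerivFwd
    rw [norm_smul, norm_inv, Real.norm_eq_abs, abs_of_pos hη]
    have h1 : ‖B7Eq78Linearization.conjR (U₀ y κ) (A' (y + e κ) τ) - A' y τ‖ ≤ α₂ * i.η⁻¹ + α₂ * i.η⁻¹ := by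
      calc ‖B7Eq78Linearization.conjR (U₀ y κ) (A' (y + e κ) τ) - A' y τ‖
          ≤ ‖B7Eq78Linearization.conjR (U₀ y κ) (A' (y + e κ) τ)‖ + ‖A' y τ‖ := norm_sub_le _ _
        _ ≤ α₂ * i.η⁻¹ + α₂ * i.η⁻¹ := by
            rw [B8Ineq132.norm_conjR (hU₀1 y κ)]
            exact add_le_add (hAglob _ _) (hAglob _ _)
    calc i.η⁻¹ * ‖B7Eq78Linearization.conjR (U₀ y κ) (A' (y + e κ) τ) - A' y τ‖
        ≤ i.η⁻¹ * (α₂ * i.η⁻¹ + α₂ * i.η⁻¹) := mul_le_mul_of_nonneg_left h1 (by positivity)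
      _ = 2 * α₂ * i.η⁻¹ * i.η⁻¹ := by ring
  have hJbd : Bdd L m i.η (-(3 : ℝ)) (fun j (b : Site d × Fin d) => BondTouches (i.Ω j) b.1 b.2)
      (fun b => Jcur i.η U₀ A' b.2 b.1) :=
    bdd_neg_three_of_pointwise hL hη fun b => norm_Jcur_le_of_grad hη hU₀1 hgrad b.2 b.1
  -- |J̃|₍₋₃₎ ≤ |J|₍₋₃₎ + c₆₉ M α₀ |A′|₍₋₁₎ + q |B₁| (pointwise: (3.26) with (3.69), the Landau condition, (3.16))
  have hJt : bondNorm L m i.η (-(3 : ℝ)) i.Ω Jt ≤ nJ + c69 * M * (K₆ * α₀) * a + q * nB := by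
    have e3 : (-(3 : ℝ)) = -((3 : ℕ) : ℝ) := by norm_num
    refine B8ScaledSupNorm.msup_le (by positivity) fun j hj b hb => ?_
    have hw : weight L i.η (-(3 : ℝ)) j = ((L : ℝ) ^ j * i.η) ^ 3 := by
      rw [e3, B8ScaledSupNorm.weight_neg_natCast]
    have hw0 : 0 ≤ ((L : ℝ) ^ j * i.η) ^ 3 := by positivity
    have h1 : weight L i.η (-(3 : ℝ)) j * ‖Jcur i.η U₀ A' b.2 b.1‖ ≤ nJ := by
      rw [hnJ_def]; exact B8ScaledSupNorm.weight_mul_norm_le_msup hJbd hj hb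
    have h2 : ((L : ℝ) ^ j * i.η) ^ 3 * ‖(ops M i m).Dp U₀ A' b.1 b.2‖ ≤ c69 * M * (K₆ * α₀) * a := by
      rw [ha_def]; exact hcurv M i m hM₃ (K₆ * α₀) U₀ hU₀ ha₉0 ha3' hreg A' hOnE j hj b.1 b.2 hb
    have h4 : ((L : ℝ) ^ j * i.η) ^ 3 * ‖(ops M i m).QQ U₀ A' b.1 b.2‖ ≤ q * nB := by
      rw [hnB_def]; exact havg M i m U₀ hU₀ A' hOnE j hj b.1 b.2 hb
    have hsum : ‖Jt b.1 b.2‖ ≤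
        ‖Jcur i.η U₀ A' b.2 b.1‖ + ‖(ops M i m).Dp U₀ A' b.1 b.2‖ + ‖(ops M i m).QQ U₀ A' b.1 b.2‖ := by
      rw [hJtb, hDRD b.1 b.2, add_zero]
      exact norm_add₃_le
    rw [hw] at h1 ⊢
    calc ((L : ℝ) ^ j * i.η) ^ 3 * ‖Jt b.1 b.2‖
        ≤ ((L : ℝ) ^ j * i.η) ^ 3 *
            (‖Jcur i.η U₀ A' b.2 b.1‖ + ‖(ops M i m).Dp U₀ A' b.1 b.2‖ + ‖(ops M i m).QQ U₀ A' b.1 b.2‖) :=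
          mul_le_mul_of_nonneg_left hsum hw0
      _ = ((L : ℝ) ^ j * i.η) ^ 3 * ‖Jcur i.η U₀ A' b.2 b.1‖ + ((L : ℝ) ^ j * i.η) ^ 3 * ‖(ops M i m).Dp U₀ A' b.1 b.2‖ +
            ((L : ℝ) ^ j * i.η) ^ 3 * ‖(ops M i m).QQ U₀ A' b.1 b.2‖ := by ring
      _ ≤ nJ + c69 * M * (K₆ * α₀) * a + q * nB := add_le_add (add_le_add h1 h2) h4
  -- Theorem 3.3's γ = −3 entries at J̃ through the dictionary ((3.47) ⇒ (1.59)), and the Hölder binder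
  obtain ⟨hw, hG0, hG1, hG3⟩ := hd U₀ hU₀ Jt
  have hline1 : a ≤ B₀ * bondNorm L m i.η (-(3 : ℝ)) i.Ω Jt := by
    have h := B9.glob_at_minus_three (GA (mem M i m)) h347 0 (ιLoc M i m Jt)
    rw [hG0, hw, hGJ, ← ha_def] at h
    exact h
  have hline2 : msup L m i.η (-(2 : ℝ)) (fun j (t : Fin d × Fin d × Site d) => SideTouches (i.Ω j) t.2.2 t.2.1)
      (fun t => covDerivFwd i.η U₀ t.1 (fun z => A' z t.2.1) t.2.2) ≤ B₀ * bondNorm L m i.η (-(3 : ℝ)) i.Ω Jt := by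
    have h := B9.glob_at_minus_three (GA (mem M i m)) h347 1 (ιLoc M i m Jt)
    rw [hG1, hw, hGJ] at h
    exact h
  have hline4 : bondNorm L m i.η (-(3 : ℝ)) i.Ω (fun x μ => covLap i.η U₀ (fun z => A' z μ) x) ≤
      B₀ * bondNorm L m i.η (-(3 : ℝ)) i.Ω Jt := by
    have h := B9.glob_at_minus_three (GA (mem M i m)) h347 3 (ιLoc M i m Jt)
    rw [hG3, hw, hGJ] at h
    exact h
  have hline5 : msup L m i.η (-(2 + β))
      (fun j (q : Fin d × Fin d × (Site d × Site d)) => q.2.2 ∈ AdmPair i.η len ∧ q.2.2.1 ∈ i.Ω j)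
      (fun q => hquot i.η β len U₀ (covDerivFwd i.η U₀ q.1 (fun z => A' z q.2.1)) q.2.2) ≤
      max 0 (CH * Bβ β) * bondNorm L m i.η (-(3 : ℝ)) i.Ω Jt := by
    have h := hhol M i m Bβ Bε Bεβ δ₀ U₀ hU₀ h345 Jt
    rw [hGJ] at h
    exact h.trans (mul_le_mul_of_nonneg_right (le_max_right _ _) (B8ScaledSupNorm.msup_nonneg L m hη.le _ _ _))
  -- the a-priori (Neumann) step of G-IF-01, in the concrete norms
  have hJJ : bondNorm L m i.η (-(3 : ℝ)) i.Ω (fun x μ => pdiv i.η U₀ (plaqCovDeriv i.η U₀ A') μ x) = nJ := by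
    rw [hnJ_def]; rfl
  rw [← ha_def, ← hnJ_def, ← hnB_def]
  exact apriori_arith hB₀ hq hκ' hθ ha0 hnJ0 hnB0 (le_max_left 0 _) hJJ hJt hline1 hline2 hline4 hline5

/-- **[4] THEOREM 3.3 (BY NAME) AT THE `ℤᵈ` CARRIER SUPPLIES THE CONSUMER'S ONE b9 TARGET AT EVERY MEMBER AND EVERY TRUNCATION LEVEL**:
`B9.Thm33Printed c35 geo bg Gp GA` for a [B9] frame reading the `ℤᵈ` data (`DictGlob`), with Proposition 6 in [4]'s shape (`Prop6Feed`) and the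
operator-letter binders of B8 p. 86 (`InvOnSupp`, `CurvSmall`, `LandauKills`, `AvgBound`, `HolderGlob`), gives constants `B₀ > 0`, `B₀β ≥ 0`,
`cP > 0` with `SockB9P3 L B₀ B₀β cP β len i.η m i.Ω i.Λs i.Λb` for every datum `i : ZdIdx d L` and every `m ≤ i.k` — the hypothesis `H` of
`B8LeafSocketsB9.sockB9P3_of_allLevels`∕`sockH59_of_allLevels` verbatim (B8 p. 88 «the same conditions for k − 1»).  The block parameter is fixed at
`M = max{1, M₁, M₃}` (M₁ = Theorem 3.3's), B₀ = max{1, 2B₀^{[4]}max{1,q}}, B₀β = 2max{0, C_H B₀^{[4]}(β)}max{1,q}.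
[cite: Balaban1985RegularSpaces, (1.59) p.86, Prop. 3 p.87, Thm 4 p.88; Balaban1985BackgroundPropagators, Thm 3.3 p.399] -/
theorem sockB9P3_allLevels_of_thm33 (hd2 : 2 ≤ d) (hL : 1 ≤ L) {c35 c₆ K₆ M₃ a₃ c69 q CH β : ℝ} {len : Site d → ℝ}
    {Gp : ∀ i, B9.KernelFamily (geo i) (bg i)} (h33 : B9.Thm33Printed c35 geo bg Gp GA)
    (hdict : DictGlob geo bg GA L mem ιCfg ιLoc ops) (hP6 : Prop6Feed bg L mem ιCfg c35 M₃ c₆ K₆)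
    (hinv : InvOnSupp bg L mem ιCfg ops c35 M₃ a₃) (hcurv : CurvSmall bg L mem ιCfg ops c35 M₃ a₃ c69)
    (hlan : LandauKills bg L mem ιCfg ops c35 M₃ a₃) (havg : AvgBound L ops q)
    (hhol : HolderGlob geo bg GA L mem ιCfg ops β len CH)
    (hc₆ : 0 < c₆) (hK₆ : 0 < K₆) (ha₃ : 0 < a₃) (hc69 : 0 ≤ c69) (hq : 0 ≤ q) :
    ∃ B₀ B₀β cP : ℝ, 0 < B₀ ∧ 0 ≤ B₀β ∧ 0 < cP ∧
      ∀ (i : ZdIdx d L) (m : ℕ), m ≤ i.k → SockB9P3 (𝔸 := 𝔸) L B₀ B₀β cP β len i.η m i.Ω i.Λs i.Λb := by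
  obtain ⟨M₁, δ₀, a₀, B₀, Bβ, Bε, Bεβ, -, -, ha₀, hB₀, H⟩ := h33
  obtain ⟨M, hM_def⟩ : ∃ M : ℝ, M = max 1 (max M₁ M₃) := ⟨_, rfl⟩
  have hM1 : 1 ≤ M := by rw [hM_def]; exact le_max_left _ _
  have hMM₁ : M₁ ≤ M := by rw [hM_def]; exact (le_max_left _ _).trans (le_max_right _ _)
  have hMM₃ : M₃ ≤ M := by rw [hM_def]; exact (le_max_right _ _).trans (le_max_right _ _)
  have hM0 : 0 < M := lt_of_lt_of_le one_pos hM1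
  have hKM : 0 < K₆ * M := mul_pos hK₆ hM0
  refine ⟨max 1 (2 * B₀ * max 1 q), 2 * max 0 (CH * Bβ β) * max 1 q,
    min (1 / 16) (min (c₆ / M) (min (a₀ / (K₆ * M)) (min (a₃ / (K₆ * M)) (1 / (2 * B₀ * c69 * K₆ * M + 1))))),
    lt_of_lt_of_le one_pos (le_max_left _ _), by positivity, ?_, fun i m _ => ?_⟩
  · refine lt_min (by norm_num) (lt_min (div_pos hc₆ hM0) (lt_min (div_pos ha₀ hKM) (lt_min (div_pos ha₃ hKM) ?_)))
    have : 0 < 2 * B₀ * c69 * K₆ * M + 1 := by positivity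
    positivity
  · refine sockB9P3_at geo bg GA L mem ιCfg ιLoc ops hd2 hL hdict hP6 hinv hcurv hlan havg hhol hK₆ hc69 hq hM1 hMM₃ i m
      (δ₀ := δ₀) (Bε := Bε) (Bεβ := Bεβ) hB₀ fun α₀ U₀ hU₀ hα₀ hMa hreg => ?_
    have hMi : M₁ ≤ (geo (mem M i m)).M := by rw [(hdict M i m).1]; exact hMM₁
    have hMa' : (geo (mem M i m)).M * α₀ ≤ a₀ := by rw [(hdict M i m).1]; exact hMa
    exact (H (mem M i m) hMi α₀ hα₀ hMa' (ιCfg M i m U₀ hU₀) hreg).2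

end Supply

#print axioms sockB9P3_at
#print axioms sockB9P3_allLevels_of_thm33

end Literature.MathematicalPhysics.QuantumFieldTheory.Balaban1983to89.B9SupplySockB9P3Zd

end
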